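/-
Copyright (c) 2026 the pub-hodgecm-mathlib formalisation cell (harness21).  Prover seat hodgecm-mathlib-K2Liu-p26 (g0): Track B «K2-LIT»,
#184♮ = hLiu418 = stmt-HodgeConjecture-24832; #42S organ S1 (local Siegel–Weil spanning), the (G) organ «`hf₀off`» for a PAIR of sections
(K2E5-plan (g7) TABLE #3 (u1) 15:10:57Z; K2Liu-p08 (g5) 14:58:59Z ⚠️ + K2Liu-p01 (g9) 15:10:20Z: the ∃-bound `hf₀off` of ★ (P2) must be PAID, cell by cell).
-/
import Summits.HodgeConjecture.HodgeConjecture.Theorems.K2LiuLocalSWMiddleCellBruhat        -- ★ (R-a) K2E5-p17: `offBigCell_cases` (`n = 2` Bruhat off the big cell)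
import Literature.NumberTheory.K2Lit.LocalDoublingSiegel                                     -- ★ `mem_siegelDeltaLoc_iff_local` (K2Lit `P_Δ(L⁺_v)` ↔ ★ D10 `IsSiegelDelta`)
import HarnessLib

/-!
# Crux `HLiu418`, #42S organ S1, the (G) organ for a PAIR: `hf₀off` FOR `f₀ = F₁ + μ·F₂` OFF THE BIG CELL, FROM THE CLOSED-CELL ROWS `F±(1) = 0`
# AND ONE MIDDLE-CELL ROW `F₁(w₁ x) + μ·F₂(w₁ x) = 0` (`x ∈ P_Δ`)

Cell `hodgecm-mathlib`, crux item hLiu418 = `stmt-HodgeConjecture-24832`, route of record `HCCMUnconditional`; squad K2 ∕ K2Liu, road `K2_Liu`, socket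
#42S (a) (local Siegel–Weil spanning at the non-split places), organ S1; LEAD F0P6-plan (g14), S1 desks K2Liu-p01 (g9) (inert), K2Liu-p08 (g5) (split).
THEOREMS ONLY (no `def`, no `instance`, no `notation`, no named-fact hypothesis, no `sorry`); lane `--supports stmt-HodgeConjecture-24832` (count-neutral helper).

WHY.  The socket ★ F3d `localDegPS_le_of_witness` takes the binder `hf₀off : ∀ h ∉ P_Δ w_Δ N_Δ, f₀ h = 0` for the witness `f₀`.  For the RAMIFIED witness
`f₀ = F + μ·(F ∘ Ad d_a)` this is ★ F7r-5 `K2LiuLocalSWRamifiedOffBigCell` (one section, an eigen-relation).  For the INERT (and split) lattice-PAIR witness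
`f₀ = F_{Φ₊} + μ·F_{Φ₋}` (★ (P1) `K2LiuInertWitnessPackage`, ★ (P2) `K2LiuLocalSWParityOscillation`; `μ = −q_v²` for consecutive levels) the binder was left
∃-bound inside ★ (P2) (K2Liu-p08 (g5)'s flag): it has to be PAID from the construction.  This file is the CELL CALCULUS of that payment, hypothesis-first, for
TWO Siegel sections `F₁, F₂ ∈ I_v(s, χ_v)` (★ D10 `IsLocalSiegelSection`: `F(p h) = χ_s(p) F(h)`, `p ∈ P_Δ`):
* §1 (any `n`, cells by value) `closedCell_add_mul_eq_zero` — on `P_Δ`: `F₁ p + μ F₂ p = χ_s(p)(F₁ 1 + μ F₂ 1) = 0` from the CLOSED-CELL ROWS `F±(1) = 0` (for the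
  lattice pair: `(ΓΦ_ε)(0) = 𝟙_{B₁}(0) − 𝟙_{B₂}(0) = 0`, the witness hand's reading ★∕📤 (H3)); `middleCell_add_mul_eq_zero` — on `P_Δ w₁ P_Δ`:
  `F₁(p w₁ x) + μ F₂(p w₁ x) = χ_s(p)·(F₁(w₁ x) + μ F₂(w₁ x)) = 0` from the ONE MIDDLE-CELL ROW `hmid : F₁(w₁ x) + μ F₂(w₁ x) = 0` (`x ∈ P_Δ`; for the lattice pair:
  ★ F6c `K2LiuLocalSWMiddleCellValues` at `Ψ := Φ_ε` + ★ (R-c) `K2LiuLatticePairMiddleProfile`); `offBigCell_add_mul_eq_zero_of_cells` — the binder from the two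
  cells and the cell decomposition `hcell` by value.
* §2 (`n = 2`, `E ⊗ F_v` a field — every NON-SPLIT `v`, inert or ramified) **`offBigCell_add_mul_eq_zero`** — `hcell` discharged by ★ (R-a)
  `K2LiuLocalSWMiddleCellBruhat.offBigCell_cases` (flip `w₁` of the line `i`, by value through its adapted matrix).
* §3 (K2Lit CM dress, `n = 2`) **`hf₀off_of_rows`** — the LITERAL `hf₀off` bytes of ★ (P2) `exists_inert_parity_witness` ∕ ★ (H1)–(H2) (off-big-cell spelled with
  the K2Lit subgroup `siegelDeltaLoc`, ★ `mem_siegelDeltaLoc_iff_local`), for ANY two sections `F₁ F₂` with the Siegel law (`hsec±` of ★ (P2) at `Φ±`), from the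
  closed-cell rows and the middle-cell row.  ⇒ the (G) organ's residual is EXACTLY the two rows for the constructed `Φ_ε` (desk K2Liu-p01 (g9)'s (H3) reading).
References: [Kudla1994] §3 Thm. 3.1; [KudlaSweet1997] §1 (degenerate principal series of `U(n,n)`, Bruhat filtration); [HarrisKudlaSweet1996] §1 (1.11), (1.15);
[BernsteinZelevinsky1976] §1.5 (cell-by-cell analysis of induced representations).
HONEST LABEL.  Count-neutral helper; it retires nothing by itself: `HC_CM` is proved only modulo the 7 printed citations (2 remaining named inputs:
hLiu418 = `stmt-HodgeConjecture-24832`, h413 = `stmt-HodgeConjecture-24833`) until rung 0 closes.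
-/

set_option autoImplicit false
-- the mandated namespace repeats the single-problem summit's segment (`HodgeConjecture.HodgeConjecture`)
set_option linter.dupNamespace false

noncomputable section

open scoped Matrix
open NumberField IsDedekindDomain Matrix
open Literature.NumberTheory.Automorphic Literature.NumberTheory.Automorphic.UnitaryGroup
open Literature.NumberTheory.GelbartRogawski1991 Literature.NumberTheory.GelbartRogawski1991.GRConstruction
open Literature.NumberTheory.GelbartRogawski1991.AdaptedBlocks
open Literature.NumberTheory.GelbartRogawski1991.UnitaryDualPair
open Literature.NumberTheory.GelbartRogawski1991.UnitaryDualPair.LocalSplitting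
open Literature.NumberTheory.K2Lit Literature.NumberTheory.K2Lit.LocalSiegelDoubled Literature.NumberTheory.K2Lit.SiegelDoubled
open Summit.HodgeConjecture.HodgeConjecture.Cruxes.HLiu418.K2LiuLocalSWMiddleCellBruhat

namespace Summit.HodgeConjecture.HodgeConjecture.Cruxes.HLiu418.K2LiuInertWitnessOffBigCell

/-! ## §1 The two cells for a pair of Siegel sections, by value -/

section Generic

variable (F : Type) [Field F] [NumberField F] (E : Type) [Field E] [NumberField E] [Algebra F E] [Algebra.IsQuadraticExtension F E]
  (c : E ≃ₐ[F] E) {δ : E} (hcδ : c δ = -δ) (hδ : δ ≠ 0) {d : F} (hd : δ * δ = algebraMap F E d)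
  (v : HeightOneSpectrum (𝓞 F)) (n : ℕ) {T₀ : Matrix (Fin n) (Fin n) F} (hT₀ : T₀.IsSymm)
  {JD : Matrix (Fin (n + n)) (Fin (n + n)) E} (hJD : JD = (gramD F n T₀).map (algebraMap F E))
  (χv : ∀ w : PlacesOver E v, (w.1.adicCompletion E)ˣ →* ℂˣ) (s : ℂ)
  {F₁ F₂ : UnitaryGroup.localPi E c (n + n) JD v → ℂ}
  (hF₁ : IsLocalSiegelSection F E c hcδ hδ hd v n hT₀ hJD χv s F₁) (hF₂ : IsLocalSiegelSection F E c hcδ hδ hd v n hT₀ hJD χv s F₂)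

include hF₁ hF₂ in
/-- **THE CLOSED CELL for a pair**: `F₁ p + μ·F₂ p = 0` on `P_Δ` as soon as `F₁ 1 = 0 = F₂ 1` (Siegel law: `F(p) = χ_s(p)·F(1)`).
[cite: Kudla1994, §3 Thm. 3.1] [cite: KudlaSweet1997, §1] -/
theorem closedCell_add_mul_eq_zero (h1₁ : F₁ 1 = 0) (h1₂ : F₂ 1 = 0) (μ : ℂ)
    (p : UnitaryGroup.localPi E c (n + n) JD v) (hp : IsSiegelDelta F E c hcδ hδ hd v n hT₀ hJD p) :
    F₁ p + μ * F₂ p = 0 := by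
  have h₁ := hF₁ p hp 1
  have h₂ := hF₂ p hp 1
  rw [mul_one] at h₁ h₂
  rw [h₁, h₂, h1₁, h1₂, mul_zero, mul_zero, add_zero]

include hF₁ hF₂ in
/-- **THE MIDDLE CELL for a pair**: `F₁(p w₁ x) + μ·F₂(p w₁ x) = χ_s(p)·(F₁(w₁ x) + μ·F₂(w₁ x)) = 0` for `p, x ∈ P_Δ`, from the ONE middle-cell row
`hmid : F₁(w₁ x) + μ·F₂(w₁ x) = 0` (`x ∈ P_Δ`). [cite: Kudla1994, §3 Thm. 3.1] [cite: HarrisKudlaSweet1996, §1 (1.15)] -/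
theorem middleCell_add_mul_eq_zero (w₁ : UnitaryGroup.localPi E c (n + n) JD v) (μ : ℂ)
    (hmid : ∀ x, IsSiegelDelta F E c hcδ hδ hd v n hT₀ hJD x → F₁ (w₁ * x) + μ * F₂ (w₁ * x) = 0)
    (p x : UnitaryGroup.localPi E c (n + n) JD v) (hp : IsSiegelDelta F E c hcδ hδ hd v n hT₀ hJD p) (hx : IsSiegelDelta F E c hcδ hδ hd v n hT₀ hJD x) :
    F₁ (p * w₁ * x) + μ * F₂ (p * w₁ * x) = 0 := by
  rw [mul_assoc, hF₁ p hp, hF₂ p hp, ← mul_assoc μ, mul_comm μ, mul_assoc, ← mul_add, hmid x hx, mul_zero]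

include hF₁ hF₂ in
/-- **`hf₀off` FROM THE TWO CELLS**: given the cell decomposition of the complement of the big cell by value (`hcell`; `n = 2`: `H ∖ P_Δ w_Δ N_Δ = P_Δ ⊔ P_Δ w₁ P_Δ`,
★ (R-a) `offBigCell_cases`), the closed-cell rows `F±(1) = 0` and the middle-cell row, `F₁ g + μ·F₂ g = 0` for every `g` off the big cell.
[cite: Kudla1994, §3 Thm. 3.1] [cite: KudlaSweet1997, §1] [cite: BernsteinZelevinsky1976, §1.5] -/
theorem offBigCell_add_mul_eq_zero_of_cells (w₁ : UnitaryGroup.localPi E c (n + n) JD v) (μ : ℂ) (h1₁ : F₁ 1 = 0) (h1₂ : F₂ 1 = 0)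
    (hmid : ∀ x, IsSiegelDelta F E c hcδ hδ hd v n hT₀ hJD x → F₁ (w₁ * x) + μ * F₂ (w₁ * x) = 0)
    (hcell : ∀ g : UnitaryGroup.localPi E c (n + n) JD v,
      (¬ ∃ p, IsSiegelDelta F E c hcδ hδ hd v n hT₀ hJD p ∧ ∃ u ∈ unipDeltaLocal F E c v n (JD := JD), g = p * weylDelta F E c v n hJD * u) →
      IsSiegelDelta F E c hcδ hδ hd v n hT₀ hJD g ∨
        ∃ p x, IsSiegelDelta F E c hcδ hδ hd v n hT₀ hJD p ∧ IsSiegelDelta F E c hcδ hδ hd v n hT₀ hJD x ∧ g = p * w₁ * x)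
    (g : UnitaryGroup.localPi E c (n + n) JD v)
    (hg : ¬ ∃ p, IsSiegelDelta F E c hcδ hδ hd v n hT₀ hJD p ∧ ∃ u ∈ unipDeltaLocal F E c v n (JD := JD), g = p * weylDelta F E c v n hJD * u) :
    F₁ g + μ * F₂ g = 0 := by
  rcases hcell g hg with hgP | ⟨p, x, hp, hx, rfl⟩
  · exact closedCell_add_mul_eq_zero F E c hcδ hδ hd v n hT₀ hJD χv s hF₁ hF₂ h1₁ h1₂ μ g hgP
  · exact middleCell_add_mul_eq_zero F E c hcδ hδ hd v n hT₀ hJD χv s hF₁ hF₂ w₁ μ hmid p x hp hx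

end Generic

/-! ## §2 `n = 2`, `E ⊗ F_v` a field (every non-split `v`): the cell decomposition is ★ (R-a) -/

section Two

variable (F : Type) [Field F] [NumberField F] (E : Type) [Field E] [NumberField E] [Algebra F E] [Algebra.IsQuadraticExtension F E]
  (c : E ≃ₐ[F] E) {δ : E} (hcδ : c δ = -δ) (hδ : δ ≠ 0) {d : F} (hd : δ * δ = algebraMap F E d)
  (v : HeightOneSpectrum (𝓞 F)) {T₀ : Matrix (Fin 2) (Fin 2) F} (hT₀ : T₀.IsSymm) (hT₀d : IsUnit T₀.det)
  {JD : Matrix (Fin (2 + 2)) (Fin (2 + 2)) E} (hJD : JD = (gramD F 2 T₀).map (algebraMap F E))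
  (χv : ∀ w : PlacesOver E v, (w.1.adicCompletion E)ˣ →* ℂˣ) (s : ℂ)
  {F₁ F₂ : UnitaryGroup.localPi E c (2 + 2) JD v → ℂ}
  (hF₁ : IsLocalSiegelSection F E c hcδ hδ hd v 2 hT₀ hJD χv s F₁) (hF₂ : IsLocalSiegelSection F E c hcδ hδ hd v 2 hT₀ hJD χv s F₂)

include hT₀d hF₁ hF₂ in
/-- **`hf₀off` FOR A PAIR, `n = 2`, NON-SPLIT `v`** (`E ⊗ F_v` a field: `hK`): for two Siegel sections `F₁, F₂ ∈ I_v(s, χ_v)` with `F₁(1) = 0 = F₂(1)`, a flip `w₁` of the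
line `i` (`hw₁`) and the middle-cell row `F₁(w₁ x) + μ·F₂(w₁ x) = 0` (`x ∈ P_Δ`): `F₁ g + μ·F₂ g = 0` for every `g` off the big cell `P_Δ w_Δ N_Δ`.
[cite: Kudla1994, §3 Thm. 3.1] [cite: KudlaSweet1997, §1] -/
theorem offBigCell_add_mul_eq_zero (hK : ∀ z : LocalRing E v, z ≠ 0 → IsUnit z) (i : Fin 2)
    {w₁ : UnitaryGroup.localPi E c (2 + 2) JD v}
    (hw₁ : adapt (matA F E c v 2 w₁) = Matrix.fromBlocks (1 - Matrix.single i i 1) (Matrix.single i i 1) (Matrix.single i i 1) (1 - Matrix.single i i 1))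
    (μ : ℂ) (h1₁ : F₁ 1 = 0) (h1₂ : F₂ 1 = 0)
    (hmid : ∀ x, IsSiegelDelta F E c hcδ hδ hd v 2 hT₀ hJD x → F₁ (w₁ * x) + μ * F₂ (w₁ * x) = 0)
    (g : UnitaryGroup.localPi E c (2 + 2) JD v)
    (hg : ¬ ∃ p, IsSiegelDelta F E c hcδ hδ hd v 2 hT₀ hJD p ∧ ∃ u ∈ unipDeltaLocal F E c v 2 (JD := JD), g = p * weylDelta F E c v 2 hJD * u) :
    F₁ g + μ * F₂ g = 0 :=
  offBigCell_add_mul_eq_zero_of_cells F E c hcδ hδ hd v 2 hT₀ hJD χv s hF₁ hF₂ w₁ μ h1₁ h1₂ hmid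
    (offBigCell_cases F E c hcδ hδ hd v hT₀ hT₀d hJD hK i hw₁) g hg

end Two

/-! ## §3 The K2Lit CM dress: the literal `hf₀off` bytes of ★ (P2) ∕ (H1)–(H2), from the rows -/

section CM

variable (L : Type) [Field L] [NumberField L] [IsCMField L]
variable {N M : ℕ} (e : Fin N × Fin M ≃ Fin 2)
  (dV : Fin N → L) (hdV : ∀ i, IsCMField.complexConj L (dV i) = dV i)
  (dW : Fin M → L) (hdW : ∀ i, IsCMField.complexConj L (dW i) = dW i)
  (v : HeightOneSpectrum (𝓞 (Fp L)))
  (χv : ∀ w : PlacesOver L v, (w.1.adicCompletion L)ˣ →* ℂˣ) (s : ℂ)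
  {F₁ F₂ : UnitaryGroup.localPi L (IsCMField.complexConj L) (2 + 2) (hermD L e dV hdV dW hdW) v → ℂ}
  (hF₁ : IsLocalSiegelSection (Fp L) L (IsCMField.complexConj L) (complexConj_imagUnit L) (imagUnit_ne_zero L) (imagUnit_mul_self L) v 2
      (gramR_isSymm L e dV hdV dW hdW) (hermD_eq_map_gramD L e dV hdV dW hdW) χv s F₁)
  (hF₂ : IsLocalSiegelSection (Fp L) L (IsCMField.complexConj L) (complexConj_imagUnit L) (imagUnit_ne_zero L) (imagUnit_mul_self L) v 2
      (gramR_isSymm L e dV hdV dW hdW) (hermD_eq_map_gramD L e dV hdV dW hdW) χv s F₂)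

include hF₁ hF₂ in
set_option maxHeartbeats 800000 in -- MEASURED: 400000 times out at `whnf` (the K2Lit CM doubled-group letters; ★ (W3) `exists_boxLevel_of_offBigCell` needs 1600000, ★ B4 800000 for the same telescope)
/-- **THE `hf₀off` BINDER OF ★ (P2) ∕ (H1)–(H2), PAID FROM THE ROWS** (K2Lit CM datum, `n = 2`, non-split `v`, the off-big-cell condition spelled with the K2Lit
subgroup `siegelDeltaLoc` as in ★ (P2) — ★ `mem_siegelDeltaLoc_iff_local`): for ANY two functions `F₁ F₂` with the Siegel law (★ (P2)'s `hsec±` at `Φ±`), a flip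
`w₁` of a line, the determinant letter `hT₀d`, and the ROWS — closed `F₁ 1 = 0`, `F₂ 1 = 0`, middle `F₁(w₁ x) + μ·F₂(w₁ x) = 0` on `P_Δ` —
`∀ h ∉ P_Δ w_Δ N_Δ, F₁ h + μ·F₂ h = 0`. [cite: Kudla1994, §3 Thm. 3.1] [cite: KudlaSweet1997, §1] -/
theorem hf₀off_of_rows (hK : ∀ z : LocalRing L v, z ≠ 0 → IsUnit z) (hT₀d : IsUnit (gramR L e dV hdV dW hdW).det) (i : Fin 2)
    {w₁ : UnitaryGroup.localPi L (IsCMField.complexConj L) (2 + 2) (hermD L e dV hdV dW hdW) v}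
    (hw₁ : adapt (matA (Fp L) L (IsCMField.complexConj L) v 2 w₁) =
      Matrix.fromBlocks (1 - Matrix.single i i 1) (Matrix.single i i 1) (Matrix.single i i 1) (1 - Matrix.single i i 1))
    (μ : ℂ) (h1₁ : F₁ 1 = 0) (h1₂ : F₂ 1 = 0)
    (hmid : ∀ x ∈ siegelDeltaLoc L e dV hdV dW hdW v, F₁ (w₁ * x) + μ * F₂ (w₁ * x) = 0) :
    ∀ h : UnitaryGroup.localPi L (IsCMField.complexConj L) (2 + 2) (hermD L e dV hdV dW hdW) v,
      (¬ ∃ p ∈ siegelDeltaLoc L e dV hdV dW hdW v, ∃ u ∈ unipDeltaLocal (Fp L) L (IsCMField.complexConj L) v 2 (JD := hermD L e dV hdV dW hdW),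
          h = p * weylDelta (Fp L) L (IsCMField.complexConj L) v 2 (T₀ := gramR L e dV hdV dW hdW) (hermD_eq_map_gramD L e dV hdV dW hdW) * u) →
      (fun h : UnitaryGroup.localPi L (IsCMField.complexConj L) (2 + 2) (hermD L e dV hdV dW hdW) v => F₁ h + μ * F₂ h) h = 0 := by
  intro h hh
  have hmid' : ∀ x, IsSiegelDelta (Fp L) L (IsCMField.complexConj L) (complexConj_imagUnit L) (imagUnit_ne_zero L) (imagUnit_mul_self L) v 2
      (gramR_isSymm L e dV hdV dW hdW) (hermD_eq_map_gramD L e dV hdV dW hdW) x → F₁ (w₁ * x) + μ * F₂ (w₁ * x) = 0 :=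
    fun x hx => hmid x ((mem_siegelDeltaLoc_iff_local L e dV hdV dW hdW v x).2 hx)
  have hg : ¬ ∃ p, IsSiegelDelta (Fp L) L (IsCMField.complexConj L) (complexConj_imagUnit L) (imagUnit_ne_zero L) (imagUnit_mul_self L) v 2
      (gramR_isSymm L e dV hdV dW hdW) (hermD_eq_map_gramD L e dV hdV dW hdW) p ∧
      ∃ u ∈ unipDeltaLocal (Fp L) L (IsCMField.complexConj L) v 2 (JD := hermD L e dV hdV dW hdW),
        h = p * weylDelta (Fp L) L (IsCMField.complexConj L) v 2 (T₀ := gramR L e dV hdV dW hdW) (hermD_eq_map_gramD L e dV hdV dW hdW) * u :=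
    fun ⟨p, hp, u, hu, hpu⟩ => hh ⟨p, (mem_siegelDeltaLoc_iff_local L e dV hdV dW hdW v p).2 hp, u, hu, hpu⟩
  exact offBigCell_add_mul_eq_zero (Fp L) L (IsCMField.complexConj L) (complexConj_imagUnit L) (imagUnit_ne_zero L) (imagUnit_mul_self L) v
    (gramR_isSymm L e dV hdV dW hdW) hT₀d (hermD_eq_map_gramD L e dV hdV dW hdW) χv s hF₁ hF₂ hK i hw₁ μ h1₁ h1₂ hmid' h hg

end CM

end Summit.HodgeConjecture.HodgeConjecture.Cruxes.HLiu418.K2LiuInertWitnessOffBigCell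

end
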